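import Summits.Ventures.HodgeRepro2.T7SupportTwoTorusInvariant
import Summits.Ventures.HodgeRepro2.T5BergmanCoefficient

/-!
# The invariant `κ` on `SU(1,1)` is the Cartan size `|a(γ h)|²` (support, seat p1)

The model `E = ℂ`, `σ = conj`, `h(x, y) = x₀ ȳ₀ − x₁ ȳ₁` (`d = ![1, -1]`) of `T7SupportTwoTorusInvariant`
is the hermitian plane of `SU(1,1)`: every `g ∈ SU(1,1)` (`gᴴ J g = J`, `J = diag(1, −1)`) is an isometry
(`isIsom_of_memU11`). With the first torus the rotation (diagonal) torus and the second orthogonal basis the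
columns of `h ∈ SU(1,1)` (so the second torus is `h K h⁻¹`), the double-coset invariant of `γ ∈ SU(1,1)` is

  `κ(γ) = |a(γ h)|² = Complex.normSq (mat (γ * h) 0 0)`   (`kappa_eq_normSq`),

the Cartan size of `γ h` (`|a(g)|² = cosh² t` for `g = k a_t k′`), and `κ(γ) ≥ 1` (`one_le_kappa`); `κ(γ) = 1`
exactly when `γ h ∈ K`, i.e. `γ ∈ K h⁻¹` — the non-regular double coset (`kappa_eq_one_iff`). Hence the decay
`‖⟨π_k(γ h) zᵐ, zⁿ⟩_k‖ ≤ C ‖a(γ h)‖^{−k}` of the bi-period (`T7SupportBergmanConjTorus`,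
`T5BergmanIntegrableKFinite`) is a decay `≤ C κ(γ)^{−k/2}` in the invariant itself.

Explicit model only; nothing about the adelic group, the global invariant, or any period.
Blind lane: Mathlib + the HodgeRepro2 prefix only; no sorry; axioms ⊆ {propext, Classical.choice, Quot.sound}.
-/

namespace Summit.Ventures.HodgeRepro2.T7SupportKappaCartan

open Matrix T5SU11Unimodular T5BergmanCoefficient T7SupportTwoTorusInvariant

/-- the signature `(1, −1)` -/
def dd : Fin 2 → ℂ := ![1, -1]

/-- the entries of `gᴴ J g = J` -/
theorem memU11_entries {g : Matrix (Fin 2) (Fin 2) ℂ} (hg : T5UnitaryBound.MemU11 g) :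
    (starRingEnd ℂ) (g 0 0) * g 0 0 - (starRingEnd ℂ) (g 1 0) * g 1 0 = 1 ∧
    (starRingEnd ℂ) (g 0 0) * g 0 1 - (starRingEnd ℂ) (g 1 0) * g 1 1 = 0 ∧
    (starRingEnd ℂ) (g 0 1) * g 0 0 - (starRingEnd ℂ) (g 1 1) * g 1 0 = 0 ∧
    (starRingEnd ℂ) (g 0 1) * g 0 1 - (starRingEnd ℂ) (g 1 1) * g 1 1 = -1 := by
  unfold T5UnitaryBound.MemU11 T5UnitaryBound.J at hg
  have h00 := congrFun (congrFun hg 0) 0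
  have h01 := congrFun (congrFun hg 0) 1
  have h10 := congrFun (congrFun hg 1) 0
  have h11 := congrFun (congrFun hg 1) 1
  simp [Matrix.mul_apply, Fin.sum_univ_two, Matrix.conjTranspose_apply] at h00 h01 h10 h11
  refine ⟨?_, ?_, ?_, ?_⟩
  · linear_combination h00
  · linear_combination h01
  · linear_combination h10
  · linear_combination h11

/-- **`SU(1,1)` acts by isometries** of `h(x, y) = x₀ ȳ₀ − x₁ ȳ₁`. -/
theorem isIsom_of_memU11 {g : Matrix (Fin 2) (Fin 2) ℂ} (hg : T5UnitaryBound.MemU11 g) :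
    IsIsom (starRingEnd ℂ) dd g := by
  obtain ⟨e00, e01, e10, e11⟩ := memU11_entries hg
  intro x y
  rw [herm_eq, herm_eq, mulVec_two, mulVec_two, mulVec_two, mulVec_two]
  simp only [dd, Matrix.cons_val_zero, Matrix.cons_val_one, map_add, map_mul]
  -- expand and use the four entry relations
  linear_combination
    (x 0 * (starRingEnd ℂ) (y 0)) * e00 + (x 0 * (starRingEnd ℂ) (y 1)) * e10 +
    (x 1 * (starRingEnd ℂ) (y 0)) * e01 + (x 1 * (starRingEnd ℂ) (y 1)) * e11

/-- `g ∈ SU(1,1)` as a matrix satisfies `gᴴ J g = J` -/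
theorem memU11_mat (g : SU11) : T5UnitaryBound.MemU11 (mat g) := by
  have := (mem_SU11_iff g.1).1 g.2
  simpa [mat] using this

/-- the columns of `h` as the second basis -/
def colBasis (h : SU11) : Fin 2 → Fin 2 → ℂ := fun j i => mat h i j

/-- the columns of `h ∈ SU(1,1)` are orthogonal for `h(·,·)` with `h(f₀, f₀) = 1`, `h(f₁, f₁) = −1` -/
theorem colBasis_disc (h : SU11) :
    herm (starRingEnd ℂ) dd (colBasis h 0) (colBasis h 1) = 0 ∧
    disc' (starRingEnd ℂ) dd (colBasis h) 0 = 1 ∧ disc' (starRingEnd ℂ) dd (colBasis h) 1 = -1 := by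
  obtain ⟨e00, e01, e10, e11⟩ := memU11_entries (memU11_mat h)
  unfold disc'
  rw [herm_eq, herm_eq, herm_eq]
  simp only [dd, colBasis, Matrix.cons_val_zero, Matrix.cons_val_one]
  refine ⟨?_, ?_, ?_⟩
  · linear_combination e10
  · linear_combination e00
  · linear_combination e11

/-- **`κ(γ) = |a(γ h)|²`**: the double-coset invariant of `γ` for the tori `K` and `h K h⁻¹` is the squared
modulus of the `(0,0)`-entry of `γ h`. -/
theorem kappa_eq_normSq (γ h : SU11) :
    kappa (starRingEnd ℂ) dd (colBasis h) (mat γ) = Complex.normSq (mat (γ * h) 0 0) := by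
  have hd := (colBasis_disc h).2.1
  have hcol : (mat γ *ᵥ colBasis h 0) 0 = mat (γ * h) 0 0 := by
    simp [mat, colBasis, Matrix.mul_apply, Matrix.mulVec, dotProduct, Fin.sum_univ_two]
  unfold kappa
  rw [hd]
  simp only [dd, Matrix.cons_val_zero, mul_one, div_one, nrm, cc, one_mul]
  rw [hcol, Complex.normSq_eq_conj_mul_self]
  ring

/-- the real relation `|a|² − |c|² = 1` for the first column of `g ∈ SU(1,1)` -/
theorem normSq_sub_normSq (g : SU11) :
    Complex.normSq (mat g 0 0) - Complex.normSq (mat g 1 0) = 1 := by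
  obtain ⟨e00, -, -, -⟩ := memU11_entries (memU11_mat g)
  have e : (Complex.normSq (mat g 0 0) : ℂ) - (Complex.normSq (mat g 1 0) : ℂ) = 1 := by
    rw [Complex.normSq_eq_conj_mul_self, Complex.normSq_eq_conj_mul_self]
    exact e00
  exact_mod_cast e

/-- `κ(γ) ≥ 1` (`|a|² − |c|² = 1` on `SU(1,1)`) -/
theorem one_le_kappa (γ h : SU11) : 1 ≤ (kappa (starRingEnd ℂ) dd (colBasis h) (mat γ)).re := by
  rw [kappa_eq_normSq, Complex.ofReal_re]
  have := normSq_sub_normSq (γ * h)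
  linarith [Complex.normSq_nonneg (mat (γ * h) 1 0)]

/-- `κ(γ) = 1` iff `γ h` has `|a| = 1`, i.e. `γ h` lies in the rotation torus `K` (`c = 0`) -/
theorem kappa_eq_one_iff (γ h : SU11) :
    kappa (starRingEnd ℂ) dd (colBasis h) (mat γ) = 1 ↔ mat (γ * h) 1 0 = 0 := by
  rw [kappa_eq_normSq, Complex.ofReal_eq_one]
  have := normSq_sub_normSq (γ * h)
  constructor
  · intro h1
    apply Complex.normSq_eq_zero.1
    linarith
  · intro hc
    rw [hc, map_zero] at this
    linarith

end Summit.Ventures.HodgeRepro2.T7SupportKappaCartan
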